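import Mathlib
import Literature.MathematicalPhysics.QuantumFieldTheory.MagnenRivasseauSeneor1993.MRS93OneLoopCounterterms
import HarnessLib

/-!
# Magnen–Rivasseau–Sénéor, *Construction of YM₄ with an infrared cutoff* (CMP 155, 1993), §VI «The Main Stability Estimate
# for a Large Field Region» — LEMMA VI.1 (VI.5) and LEMMA VI.2 (VI.20a/b) AS PRINTED, the Feynman-gauge determinant (VI.15),
# (VI.19) as printed, and the printed assembly (VI.35) «Lemma VI.2 + (III.7) ⟹ Lemma VI.1» kernel-checked

statement-level skeleton of published theorems with citation tags; proofs where landed; nothing here is a claim about the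
Yang–Mills mass gap, about continuum YM₄ on T⁴, or about the Clay problem

**Citation header (reproduction of PUBLISHED work).** J. Magnen, V. Rivasseau, R. Sénéor, *Construction of YM₄ with an infrared
cutoff*, Commun. Math. Phys. **155** (1993) 325–383 [MagnenRivasseauSeneor1993], Sect. VI pp. 368–374 and Sect. V.F pp. 367–368.
Loci «p.NNN [PDF nn] tl.k» = journal page, PDF page (= journal page − 324), text-layer line of the held Project-Euclid scan
`paper:magnen1993-cmp155-mrs-ym4-infrared-cutoff` (PDF sha256 fa4ddac3…). Every DISPLAY below was read on the page images
`run/shared/lean/pub/lit-balaban/inprint/lit-balaban-p14/renders-cmp155/` (`p44_full_s6.png`, `p45_full_s6.png`, `p48_full_s6.png`,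
`p49_full_s6.png`, `p50_full_s6.png`, crops `p50_top_s2.png`, `p50_lemmaVI2_s2.png`, `p50_VI35_s2.png`) — the text layer drops the
display (VI.5) entirely and garbles (VI.14), (VI.19), (VI.20). Cell pub-balaban-gaps (YM blitz, track G3), seat mrs-lit-2; companion record
`run/shared/lean/pub/pub-balaban-gaps/g3/MRS-AS-PRINTED-estimates.md`. Imports `MRS93OneLoopCounterterms` (the tree's kernel-check of
Lemma III.1's arithmetic and of (VI.16)–(VI.18)) for `OneLoop.bosonFirstOrder`; nothing of it is restated.

**Grade of record (lit-balaban YM-INPRINT.md row D1; not this file's to change).** Lemma VI.1: **PROOF given Lemma VI.2** (p.369 –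
p.374 tl.27 «This achieves the proof of the lemma»), fully explicit only in the Feynman gauge `ζ = 1` ((VI.15) + Appendix 1); for the
homothetic gauge actually used, the 12 × 12 determinant polynomial `P` is NOT computed (p.373 tl.15–16 «In the general case we do not
attempt the computation of P, but we compute only … its first order term in β»). Lemma VI.2: **SKETCH** (fit-ref B ruling: p.374 tl.4–8
«it is easy to check the following lemma», one-sentence compactness warrant, constants `K₁, K₂` not derived). This file types both
statements, proves the elementary (VI.19) exactly as printed, and kernel-checks the printed passage from Lemma VI.2 and (III.7) to
(VI.35); it does not compute `P` and upgrades nothing.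

**What the paper prints (verbatim; displays from the page images).**
* p.368 [PDF 44] tl.12–16: «In this section we prove that the non-trivial factor associated to the large field regions which come from
  the B dependent gauge fixing and functional integration in the associated small field regions can be bounded uniformly in B by 1, if
  the ultraviolet cutoff is of a certain stabilizing shape. This result (a kind of non-perturbative stability) is at the core of our
  whole analysis.» (VI.1) p.368: «g_{i,α,Δ}(B) = (det_{i,α,Δ}(FP) / det_{i,α,Δ}(BF)^{1/2}) e^{CT_{i,α,Δ} − λ²/2 ∫_Δ [B,B]²}, where Δ ∈ 𝐃^{i,α}
  is a cube of scale i, α, hence of volume |Δ| = M^{−3i−α} (at most λ^{−1}M^{−4i}); det_{i,α,Δ}(BF) means the determinant with the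
  appropriate cutoffs corresponding to our background dependent measure on the small field region associated to Δ … Finally CT_{i,α,Δ}
  is the associated set of counterterms (which contains a positive, potentially dangerous B² counterterm and a B⁴ counterterm, which
  thanks to our choice of ultraviolet cutoff is negative and stabilizing) … Similarly det_{i,α,Δ}(FP) is the background dependent
  determinant corresponding to the integration over the ghosts …; it is equal to an ordinary Fadeev-Popov determinant.»
* p.369 [PDF 45] tl.9–13: «Using the Euclidean and global SU(2) symmetry and the fact that B₀ = 0 (because of the axial gauge), we can
  explore completely the function g_{i,α,Δ} by considering a field B with only two non-zero components B₁¹ = x/λ and B₂² = y/λ. Then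
  λ²B² = x² + y² and λ⁴[B,B]² = x²y². The function g_{i,α,Δ} becomes a symmetric function of x and y. We are going to prove the
  following uniform estimate:» **Lemma VI.1** tl.14–15 + display (image): «For a sufficiently wide ultraviolet cutoff (in the sense of
  the parameter η in (II.14) being small) we have: g_{i,α,Δ}(x, y) ≤ 1. (VI.5)»
* p.372 [PDF 48] tl.8–18: «We introduce the variables u ≡ p²M^{−2i}, θ and φ such that p₁² = uM^{2i}cos²θ and p₂² = uM^{2i}sin²θcos²φ.
  Then d⁴p is proportional to M^{4i} u du sin²θ sinφ dθ dφ. We represent the effect of the infrared and ultraviolet cutoffs by the cutoff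
  κ_{i,α}(p) = κ_{ρ−i}(p²M^{−2i}) ≡ κ_k(u), k = ρ − i. … We can suppose that y ≤ x, since the function g_{i,α,Δ} is symmetric in x and
  y. We put v = p²/x² = uM^{2i}/x², β = κ_k(u)/v = x²M^{−2i}κ_k(u)/u (β is a function of k, u and x), κ = κ_k(u) and y = tx, t ∈ [0,1].
  Remark that |Δ|M^{+4i} = M^{i−α}.» (VI.14) p.372: «g_{i,α,Δ}(x,y) = g_{k,α}(x,t) = exp(|Δ|M^{4i}([∫₀^∞ u du (2/π)∫₀^π sin²θ dθ (1/2)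
  ∫₀^π sinφ dφ × ln|1 − βκ[cos²θ + t²sin²θcos²φ]| − (1/2)ln(1 + βP(β,κ,t,cosθ,sinφ,ζ,1/ζ))] + [∫₀^∞ u du (β/2)[6(1 + (1/ζ−1)/4) −
  κ(4 + 3(1/ζ−1)/2)](1+t²)] − [∫₀^∞ u du (β²/24)[(36 + 18(1/ζ−1) + 7.5(1/ζ−1)²) − κ(90 + 45(1/ζ−1) + 15(1/ζ−1)²) + κ²(54 + 27(1/ζ−1)
  + 7.5(1/ζ−1)²)](1+t²)²])), where P is a polynomial in all the variables listed, whose explicit computation requires the evaluation of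
  the twelve by twelve determinant (VI.9).» (VI.15): «In the case of the Feynman gauge ζ = 1, … (1 + βP(β,κ,t,cosθ,sinφ,ζ,1/ζ)) =
  [[1 + 2β(1 − 2κ(cos²θ + t²sin²θcos²φ)) + β²] + βt²[2 − β(t² + 3 − 4κ(cos²θ + sin²θcos²φ)) + β²(1+t²)]]⁴.»
* (VI.17) p.373 [PDF 49]: «= (β/2)(1+t²)(−6(1 + (1/ζ−1)/4) − 2ζ(1 + (1/ζ−1)/4) + κ[(9/2) + (3/2)(1/ζ−1) − 2 + (3/2)ζ]) + O(β²)»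
  (the tree's `OneLoop.bosonFirstOrder`); (VI.18): «≅_{β→0} (β/2)(1+t²)[−3ζ/2 − 1/2 − κ(2 − (3/2)ζ)] + O(β²)».
* (VI.19) p.374 [PDF 50] tl.2–3 (image `p50_top_s2.png`): «If we restrict us to the region 0 ≤ ζ ≤ 1, we have
  (β/2)(1 + t²)[−3ζ/2 − 1/2 − κ(2 − (3/2)ζ)] ≤ −(β/4)(1 + κ) ≤ −(β/4). (VI.19)» [The tree's `OneLoop.ineq_VI19` renders this
  from the text layer as «0 < ζ < 1», «< −(β/4)(1 + t²) ≤ −(β/4)» — the layer prints κ as «ft»; the IMAGE has «(1 + κ)» and «≤»;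
  both inequalities are true; `ineq_VI19_asPrinted` below is the printed one.]
* p.374 tl.4–8: «Now using the fact that κ, t, cosθ, sinφ, ζ and ζ⁻¹ all vary in compact intervals (for ζ and ζ⁻¹ this is because we can
  restrict us to a small interval centered respectively around 3/13 or 13/3), and the fact that the logarithms of explicit polynomials in
  β such as those of (VI.14) are bounded by a constant times β at large β (uniform in κ, t, cosθ, sinφ, ζ and ζ⁻¹ by compactness) it is
  easy to check the following lemma:» **Lemma VI.2** tl.9–16 (images `p50_lemmaVI2_s2.png`, `p50_full_s6.png`): «If 0 ≤ ζ ≤ 1 there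
  exists two (large…) constants K₁ and K₂ such that (2/π)∫₀^π sin²θ dθ (1/2)∫₀^π sinφ dφ ln|1 − βκ[cos²θ + t²sin²θcos²φ]| − (1/2)ln(1 +
  βP(β,κ,t,cosθ,sinφ,ζ,1/ζ)) + [∫ u du (β/2)[6(1 + (1/ζ−1)/4) − κ(4 + 3(1/ζ−1)/2)](1+t²)] ≤ K₂β if β ≥ (K₁)⁻¹ (VI.20a); ≤ −(β/8) if
  β ≤ (K₁)⁻¹. (VI.20b)» [The «∫ u du» inside the third bracket is as printed; by (VI.18), whose left side is the same expression
  without it, the lemma concerns the integrand at fixed u.]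
* p.374 tl.17–27 + (VI.35) (image `p50_VI35_s2.png`): «We can then complete the proof of Lemma VI.1. Indeed we write (using the fact
  that β = κ/v and 0 ≤ κ ≤ 1 and using (III.7)): g_k(x) ≤ exp(|Δ|(x⁴[∫_{v<K₁} K₂βv dv − [∫ v dv (β²/24)[(36 + 18(1/ζ−1) + 7.5(1/ζ−1)²)
  − κ(90 + 45(1/ζ−1) + 15(1/ζ−1)²) + κ²(54 + 27(1/ζ−1) + 7.5(1/ζ−1)²)](1+t²)²]])) ≤ exp(|Δ|x⁴[K₁K₂ − |log η|]) ≤ 1 (VI.35) if, again,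
  we choose the parameter η in Sect. III sufficiently small so that |log η| ≥ K₁K₂. This achieves the proof of the lemma.» [The
  display number jumps from (VI.20) to (VI.35) in print.]

**What is typed / proved here (zero `sorry`; zero closed named facts — the `def … : Prop` are predicates on explicit data).**
* §1 `DressingFactor`, `LemmaVI1Printed` — Lemma VI.1 / (VI.5) as a predicate on the family `g η i α x y` (the dressing factor of the
  cube of scale `(i, α)` at background `(x, y)`, for cutoff parameter `η`): `∃ η₀ > 0, ∀ η ∈ (0, η₀], ∀ i α x y, g ≤ 1`.
* §2 `LemmaVI2Printed` — Lemma VI.2 / (VI.20a/b) as a predicate on the ANGLE-AVERAGED INTEGRAND `F β κ t ζ` of (VI.14) (left side of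
  (VI.18)); for each `ζ ∈ [0,1]`: `∃ K₁, K₂ > 0, ∀ β ≥ 0, κ ∈ [0,1], t ∈ [0,1]`, the two printed branches.
* §3 `ineq_VI19_asPrinted` — (VI.19) with «(1 + κ)» and «≤», for `0 ≤ ζ ≤ 1`, `κ ≥ 0`, `β ≥ 0`, every `t` (proved).
* §4 `onePlusBetaP_feynman` — the printed Feynman-gauge determinant (VI.15) as a definition (`= 1` at `β = 0`);
  `onePlusBetaP_feynman_firstOrder` — the exact identity `(1 + βP)|_{ζ=1} = 1 + [8(1 + t²) − 16κ(cos²θ + t²sin²θcos²φ)]β + β²R(β)` with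
  an explicit polynomial remainder (its first order in `β`); `feynman_firstOrder_matches_VI17` — after the angular average
  `⟨cos²θ + t²sin²θcos²φ⟩ = (1+t²)/4` (`OneLoop.angularAverage_FP`), `−½` of it equals `(β/2)(1+t²)·bosonFirstOrder 1 κ`, i.e. (VI.15)
  and (VI.17) AGREE at `ζ = 1` (a printed-numbers consistency check the paper leaves to the reader).
* §5 THE PRINTED ASSEMBLY (VI.35), kernel-checked on abstract data: `region_of_beta` («using the fact that β = κ/v and 0 ≤ κ ≤ 1»:
  `β ≥ K₁⁻¹ ⟹ v ≤ K₁` and `vK₂β ≤ K₂`), `integrand_le_indicator` (Lemma VI.2's two branches ⟹ the `v`-integrand is `≤ K₂` on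
  `(0, K₁]` and `≤ 0` beyond), `integral_le_K1K2` (`⟹ ∫₀^∞ … dv ≤ K₁K₂`), and `dressingFactor_le_one` — IF `ln g = |Δ|x⁴(∫₀^∞ vF dv −
  CT₄)` (the representation (VI.14) in the variables of p.372, third bracket `= x⁴·CT₄`), the integrand obeys Lemma VI.2, `CT₄ ≥ |log η|`
  ((III.7) in these units, as invoked on p.374) and `|log η| ≥ K₁K₂`, THEN `g ≤ 1`. Hypotheses named, nothing smuggled: this is
  exactly the implication the print asserts between its displays, with the analytic inputs ((VI.14), Lemma VI.2, (III.7)) explicit.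

**Readings (declared).** (i) `F β κ t ζ` is the θ,φ-averaged integrand of the first two brackets of (VI.14) at fixed `u` — the left side
of (VI.18) — with the polynomial `P` left abstract (it is not computed in print for `ζ ≠ 1`). (ii) Lemma VI.2 is typed per `ζ` (as
printed: «If 0 ≤ ζ ≤ 1 there exists … K₁ and K₂»); the surrounding text wants uniformity on a compact `ζ`-interval around `3/13`, which the
construction (fixed `ζ`) does not need; `β ≥ 0` (it is `κ_k(u)/v`) and `κ, t ∈ [0,1]` (p.372, p.374 tl.17–18) are the printed ranges.
(iii) In §5 the change of variables `u ↦ v` (`|Δ|M^{4i}∫u du(…) = |Δ|x⁴∫v dv(…)`) is absorbed into the representation hypothesis; the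
counterterm bracket enters only through `CT₄ ≥ |log η|`. (iv) `0 ≤ ζ ≤ 1` is the printed range although `1/ζ` occurs; (VI.19) holds on
the closed range as an inequality between the displayed polynomials (at `ζ = 0` read `1/ζ − 1` as a free parameter: it cancels).

**What is NOT claimed.** The operators `BF` (VI.2)/(VI.9)–(VI.12) and `FP` (VI.4)/(VI.13), their determinants, the derivation of
(VI.14), the polynomial `P` for `ζ ≠ 1`, Lemma VI.2 itself, (III.7) itself, Appendix 1 — none is formalised here; nor anything about the
homothetic gauge beyond `ζ ∈ [0,1]`. Nothing here bears on Bałaban's papers.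
-/

noncomputable section

open Real MeasureTheory Set

namespace Literature.MathematicalPhysics.QuantumFieldTheory.MagnenRivasseauSeneor1993

namespace Stability

/-! ## §1 Lemma VI.1 (VI.5) as a typed predicate -/

/-- Statement-level carrier for Sect. VI: `g η i α x y` = the large-field dressing factor `g_{i,α,Δ}(x, y)` of (VI.1) for a cube
`Δ ∈ 𝐃^{i,α}` (by translation invariance of the constant-background problem it depends on `Δ` only through `(i, α)`), at the
two-parameter background `B₁¹ = x/λ`, `B₂² = y/λ` of p.369 tl.9–13, computed with the stabilizing cutoff (II.14) of parameter `η`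
(on which `CT_{i,α,Δ}` and the cutoffs in the determinants depend, p.368). [cite: MagnenRivasseauSeneor1993, §VI (VI.1) p.368] -/
structure DressingFactor where
  /-- `g η i α x y = g_{i,α,Δ}(x,y)` of (VI.1)/(VI.5) at cutoff parameter `η` -/
  g : ℝ → ℕ → ℕ → ℝ → ℝ → ℝ

/-- **Lemma VI.1** p.369 [PDF 45] tl.14–15 with its display (VI.5) (page image `p45_full_s6.png`), verbatim: «For a sufficiently wide
ultraviolet cutoff (in the sense of the parameter η in (II.14) being small) we have: `g_{i,α,Δ}(x, y) ≤ 1`. (VI.5)» — p.368 tl.14: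
«bounded uniformly in B by 1». Quantifiers: `∃ η₀ > 0` (depending on the cutoff shape `τ` and the gauge interval only), then EVERY
`η ∈ (0, η₀]`, every slice pair `(i, α)` and every background `(x, y)`. GRADE OF RECORD: PROOF given Lemma VI.2 (explicit at `ζ = 1`).
A typed predicate, never a `theorem` here. [cite: MagnenRivasseauSeneor1993, §VI Lemma VI.1 (VI.5) p.369] -/
def LemmaVI1Printed (D : DressingFactor) : Prop :=
  ∃ η₀ : ℝ, 0 < η₀ ∧ ∀ η : ℝ, 0 < η → η ≤ η₀ → ∀ (i α : ℕ) (x y : ℝ), D.g η i α x y ≤ 1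

/-! ## §2 Lemma VI.2 (VI.20a/b) as a typed predicate -/

/-- **Lemma VI.2** p.374 [PDF 50] tl.9–16 (images `p50_lemmaVI2_s2.png`, `p50_full_s6.png`), verbatim: «If 0 ≤ ζ ≤ 1 there exists two
(large…) constants K₁ and K₂ such that
`(2/π)∫₀^π sin²θ dθ (1/2)∫₀^π sinφ dφ ln|1 − βκ[cos²θ + t²sin²θcos²φ]| − (1/2)ln(1 + βP(β,κ,t,cosθ,sinφ,ζ,1/ζ))`
`+ [∫ u du (β/2)[6(1 + (1/ζ−1)/4) − κ(4 + 3(1/ζ−1)/2)](1 + t²)]`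
`≤ K₂β if β ≥ (K₁)⁻¹` (VI.20a) `≤ −(β/8) if β ≤ (K₁)⁻¹`. (VI.20b)» The left side is typed as an abstract function `F β κ t ζ`
(reading (i): the angle-averaged integrand of (VI.14) at fixed `u`, `P` uncomputed in print for `ζ ≠ 1`). Quantifiers: for each
`ζ ∈ [0,1]`, `∃ K₁ > 0, K₂ > 0`, `∀ β ≥ 0, κ ∈ [0,1], t ∈ [0,1]`. GRADE OF RECORD: SKETCH («it is easy to check», p.374 tl.8).
A typed predicate, never a `theorem` here. [cite: MagnenRivasseauSeneor1993, §VI Lemma VI.2 (VI.20a)–(VI.20b) p.374] -/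
def LemmaVI2Printed (F : ℝ → ℝ → ℝ → ℝ → ℝ) : Prop :=
  ∀ ζ : ℝ, 0 ≤ ζ → ζ ≤ 1 → ∃ K₁ K₂ : ℝ, 0 < K₁ ∧ 0 < K₂ ∧
    ∀ β κ t : ℝ, 0 ≤ β → 0 ≤ κ → κ ≤ 1 → 0 ≤ t → t ≤ 1 →
      (K₁⁻¹ ≤ β → F β κ t ζ ≤ K₂ * β) ∧ (β ≤ K₁⁻¹ → F β κ t ζ ≤ -(β / 8))

/-! ## §3 (VI.19) exactly as printed -/

/-- **(VI.19)** p.374 [PDF 50] tl.2–3, page image `p50_top_s2.png`, verbatim: «If we restrict us to the region 0 ≤ ζ ≤ 1, we have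
`(β/2)(1 + t²)[−3ζ/2 − 1/2 − κ(2 − (3/2)ζ)] ≤ −(β/4)(1 + κ) ≤ −(β/4)`. (VI.19)» — for `β ≥ 0`, `κ ≥ 0` and every `t` (the bracket is
`≤ −(1 + κ)/2 < 0` on `0 ≤ ζ ≤ 1`, and `1 + t² ≥ 1`). (The tree's `OneLoop.ineq_VI19` is the text-layer variant «< −(β/4)(1 + t²)»,
also true; this is the printed display.) [cite: MagnenRivasseauSeneor1993, §VI (VI.19) p.374] -/
theorem ineq_VI19_asPrinted {ζ κ β : ℝ} (hζ0 : 0 ≤ ζ) (hζ1 : ζ ≤ 1) (hκ : 0 ≤ κ) (hβ : 0 ≤ β) (t : ℝ) :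
    β / 2 * (1 + t ^ 2) * (-3 * ζ / 2 - 1 / 2 - κ * (2 - 3 / 2 * ζ)) ≤ -(β / 4) * (1 + κ) ∧
      -(β / 4) * (1 + κ) ≤ -(β / 4) := by
  constructor
  · have hbr : -3 * ζ / 2 - 1 / 2 - κ * (2 - 3 / 2 * ζ) ≤ -(1 + κ) / 2 := by nlinarith
    have hneg : -3 * ζ / 2 - 1 / 2 - κ * (2 - 3 / 2 * ζ) ≤ 0 := by linarith
    have ht : (1 : ℝ) ≤ 1 + t ^ 2 := by nlinarith [sq_nonneg t]
    -- (β/2)(1+t²)·b ≤ (β/2)·1·b ≤ (β/2)(−(1+κ)/2)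
    have h1 : β / 2 * (1 + t ^ 2) * (-3 * ζ / 2 - 1 / 2 - κ * (2 - 3 / 2 * ζ)) ≤
        β / 2 * 1 * (-3 * ζ / 2 - 1 / 2 - κ * (2 - 3 / 2 * ζ)) := by
      have : β / 2 * (1 + t ^ 2) ≥ β / 2 * 1 := by nlinarith
      nlinarith
    nlinarith
  · nlinarith

/-! ## §4 The Feynman-gauge determinant (VI.15) and its first order against (VI.17) -/

/-- **(VI.15)** p.372 [PDF 48], verbatim: «In the case of the Feynman gauge ζ = 1, this determinant simplifies into a three by three
determinant to the fourth power, which is easily computed, and one finds: `(1 + βP(β, κ, t, cosθ, sinφ, ζ, 1/ζ)) = [[1 + 2β(1 −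
2κ(cos²θ + t²sin²θcos²φ)) + β²] + βt²[2 − β(t² + 3 − 4κ(cos²θ + sin²θcos²φ)) + β²(1 + t²)]]⁴`.» Typed as the printed function of
`(β, κ, t, θ, φ)` — AS PRINTED, including the sign «− β(t² + 3 − 4κ(…))» of the `t²`-bracket. NOTE (seat mrs-lit-2 gen 2, recorded not
repaired): the 3 × 3 determinant computed in the kernel from the printed matrices (VI.6)–(VI.13), and the paper's own restatement (A.6)
p.379 («βτ[2 + β(τ + 3 − 4κ(cos²θ + sin²θcos²φ)) + β²(1 + τ)]», τ = t²), give «+» there — `FeynmanGauge.VI15_asPrinted_ne_det` / `VI15_asPrinted_eq_corrected_sub` in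
`MRS93LemmaVI2FeynmanGauge.lean` (which imports this file and proves Lemma VI.2 at ζ = 1 from the determinant); the first order in `β`
(`onePlusBetaP_feynman_firstOrder`, the match with (VI.17)) is the same for both signs. [cite: MagnenRivasseauSeneor1993, §VI (VI.15) p.372; App. 1 (A.6) p.379] -/
def onePlusBetaP_feynman (β κ t θ φ : ℝ) : ℝ :=
  ((1 + 2 * β * (1 - 2 * κ * (Real.cos θ ^ 2 + t ^ 2 * Real.sin θ ^ 2 * Real.cos φ ^ 2)) + β ^ 2) +
    β * t ^ 2 * (2 - β * (t ^ 2 + 3 - 4 * κ * (Real.cos θ ^ 2 + Real.sin θ ^ 2 * Real.cos φ ^ 2)) + β ^ 2 * (1 + t ^ 2))) ^ 4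

/-- (VI.15) is normalised: at `β = 0` it equals `1` (p.368 tl.4–5: «the proper normalization means simply that at B(Δ) = 0 this
quotient of determinants is simply 1» — `β = x²M^{−2i}κ/u` vanishes with the background). [cite: MagnenRivasseauSeneor1993, §VI (VI.15) p.372] -/
theorem onePlusBetaP_feynman_zero (κ t θ φ : ℝ) : onePlusBetaP_feynman 0 κ t θ φ = 1 := by
  unfold onePlusBetaP_feynman
  ring

/-- The inner bracket of (VI.15) collected in powers of `β`: with `A = cos²θ + t²sin²θcos²φ`, `A′ = cos²θ + sin²θcos²φ` it is
`1 + c₁β + c₂β² + c₃β³`, `c₁ = 2(1 − 2κA) + 2t²`, `c₂ = 1 − t²(t² + 3 − 4κA′)`, `c₃ = t²(1 + t²)`; the explicit `O(β²)` remainder of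
its fourth power, `R = 4(c₂ + c₃β) + 6S² + 4βS³ + β²S⁴` with `S = c₁ + c₂β + c₃β²`. [cite: MagnenRivasseauSeneor1993, §VI (VI.15) p.372] -/
def feynmanRemainder (β κ t θ φ : ℝ) : ℝ :=
  let A := Real.cos θ ^ 2 + t ^ 2 * Real.sin θ ^ 2 * Real.cos φ ^ 2
  let A' := Real.cos θ ^ 2 + Real.sin θ ^ 2 * Real.cos φ ^ 2
  let c₁ := 2 * (1 - 2 * κ * A) + 2 * t ^ 2
  let c₂ := 1 - t ^ 2 * (t ^ 2 + 3 - 4 * κ * A')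
  let c₃ := t ^ 2 * (1 + t ^ 2)
  let S := c₁ + c₂ * β + c₃ * β ^ 2
  4 * (c₂ + c₃ * β) + 6 * S ^ 2 + 4 * β * S ^ 3 + β ^ 2 * S ^ 4

/-- **The first order in `β` of the printed Feynman-gauge determinant (VI.15)**, as an exact polynomial identity:
`(1 + βP)|_{ζ=1} = 1 + [8(1 + t²) − 16κ(cos²θ + t²sin²θcos²φ)]·β + β²·R(β)` with the explicit remainder `feynmanRemainder` (so the
linear coefficient — «its first order term in β», p.373 tl.16 — is `8(1 + t²) − 16κA`). [cite: MagnenRivasseauSeneor1993, §VI (VI.15), (VI.17) pp.372–373] -/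
theorem onePlusBetaP_feynman_firstOrder (β κ t θ φ : ℝ) :
    onePlusBetaP_feynman β κ t θ φ =
      1 + (8 * (1 + t ^ 2) - 16 * κ * (Real.cos θ ^ 2 + t ^ 2 * Real.sin θ ^ 2 * Real.cos φ ^ 2)) * β +
        β ^ 2 * feynmanRemainder β κ t θ φ := by
  unfold onePlusBetaP_feynman feynmanRemainder
  ring

/-- **(VI.15) and (VI.17) agree at `ζ = 1`** (a check the print leaves to the reader, cf. p.373 tl.1–12 on the relative
normalisation): `−½ · d/dβ(1 + βP)|₀` with the angular average `⟨cos²θ + t²sin²θcos²φ⟩ = (1 + t²)/4` (`OneLoop.angularAverage_FP`)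
substituted, i.e. `−½(8(1 + t²) − 16κ·(1 + t²)/4)`, equals `(1/2)(1 + t²)·bosonFirstOrder 1 κ = (1/2)(1 + t²)(−8 + 4κ)` — the
(VI.17) bracket `−6(1 + (1/ζ−1)/4) − 2ζ(1 + (1/ζ−1)/4) + κ[9/2 + (3/2)(1/ζ−1) − 2 + (3/2)ζ]` at `ζ = 1`.
[cite: MagnenRivasseauSeneor1993, §VI (VI.15), (VI.17) pp.372–373] -/
theorem feynman_firstOrder_matches_VI17 (κ t : ℝ) :
    -(1 / 2) * (8 * (1 + t ^ 2) - 16 * κ * ((1 + t ^ 2) / 4)) = 1 / 2 * (1 + t ^ 2) * OneLoop.bosonFirstOrder 1 κ := by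
  unfold OneLoop.bosonFirstOrder
  ring

/-! ## §5 The printed assembly (VI.35): Lemma VI.2 + (III.7) ⟹ Lemma VI.1 -/

/-- p.374 tl.17–18 «using the fact that β = κ/v and 0 ≤ κ ≤ 1»: for `v > 0`, `κ ∈ [0,1]`, `K₁ > 0` and `β = κ/v`, the (VI.20a)
region `β ≥ K₁⁻¹` lies in `v ≤ K₁`, and there `v·(K₂β) = K₂κ ≤ K₂` (`K₂ ≥ 0`). [cite: MagnenRivasseauSeneor1993, §VI (VI.35) p.374] -/
theorem region_of_beta {v κ K₁ K₂ : ℝ} (hv : 0 < v) (hκ1 : κ ≤ 1) (hK₁ : 0 < K₁) (hK₂ : 0 ≤ K₂)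
    (hβ : K₁⁻¹ ≤ κ / v) : v ≤ K₁ ∧ v * (K₂ * (κ / v)) ≤ K₂ := by
  constructor
  · rw [le_div_iff₀ hv] at hβ
    have h1 : K₁⁻¹ * v ≤ 1 := hβ.trans hκ1
    calc v = K₁ * (K₁⁻¹ * v) := by field_simp
      _ ≤ K₁ * 1 := mul_le_mul_of_nonneg_left h1 hK₁.le
      _ = K₁ := mul_one K₁
  · have : v * (K₂ * (κ / v)) = K₂ * κ := by field_simp
    rw [this]
    nlinarith

/-- The two branches of Lemma VI.2 turn the `v`-integrand of (VI.35), `Φ(v) = v·F(κ(v)/v, κ(v), t, ζ)`, into: `Φ(v) ≤ K₂` for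
`0 < v ≤ K₁` and `Φ(v) ≤ 0` for `v > K₁` — written as `Φ v ≤ (Iic K₁).indicator (fun _ => K₂) v` on `v > 0`.
[cite: MagnenRivasseauSeneor1993, §VI (VI.20), (VI.35) p.374] -/
theorem integrand_le_indicator {F : ℝ → ℝ → ℝ} {κ : ℝ → ℝ} {K₁ K₂ : ℝ} (hK₁ : 0 < K₁) (hK₂ : 0 ≤ K₂)
    (hκ : ∀ v, 0 ≤ κ v ∧ κ v ≤ 1)
    (h20a : ∀ β k : ℝ, 0 ≤ k → k ≤ 1 → K₁⁻¹ ≤ β → F β k ≤ K₂ * β)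
    (h20b : ∀ β k : ℝ, 0 ≤ k → k ≤ 1 → 0 ≤ β → β ≤ K₁⁻¹ → F β k ≤ -(β / 8))
    {v : ℝ} (hv : 0 < v) :
    v * F (κ v / v) (κ v) ≤ (Iic K₁).indicator (fun _ => K₂) v := by
  obtain ⟨hk0, hk1⟩ := hκ v
  have hβ0 : 0 ≤ κ v / v := div_nonneg hk0 hv.le
  by_cases hcase : K₁⁻¹ ≤ κ v / v
  · obtain ⟨hvK, hbd⟩ := region_of_beta hv hk1 hK₁ hK₂ hcase
    have hind : (Iic K₁).indicator (fun _ => K₂) v = K₂ := by simp [Set.indicator, hvK]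
    rw [hind]
    exact (mul_le_mul_of_nonneg_left (h20a _ _ hk0 hk1 hcase) hv.le).trans hbd
  · rw [not_le] at hcase
    have hF : F (κ v / v) (κ v) ≤ -(κ v / v / 8) := h20b _ _ hk0 hk1 hβ0 hcase.le
    have hle0 : v * F (κ v / v) (κ v) ≤ 0 := by
      have : v * F (κ v / v) (κ v) ≤ v * (-(κ v / v / 8)) := mul_le_mul_of_nonneg_left hF hv.le
      have h2 : v * (-(κ v / v / 8)) ≤ 0 := by
        have : 0 ≤ v * (κ v / v / 8) := by positivity
        linarith
      exact this.trans h2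
    have hind0 : 0 ≤ (Iic K₁).indicator (fun _ => K₂) v := by
      by_cases h : v ∈ Iic K₁ <;> simp [Set.indicator, h, hK₂]
    exact hle0.trans hind0

/-- «`∫_{v<K₁} K₂βv dv ≤ K₁K₂`» (p.374, inside (VI.35)): a `v`-integrand on `(0, ∞)` that is `≤ K₂` on `(0, K₁]` and `≤ 0` beyond
has integral `≤ K₁K₂`. [cite: MagnenRivasseauSeneor1993, §VI (VI.35) p.374] -/
theorem integral_le_K1K2 {Φ : ℝ → ℝ} {K₁ K₂ : ℝ} (hK₁ : 0 < K₁)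
    (hΦint : IntegrableOn Φ (Ioi 0)) (hΦ : ∀ v, 0 < v → Φ v ≤ (Iic K₁).indicator (fun _ => K₂) v) :
    ∫ v in Ioi 0, Φ v ≤ K₁ * K₂ := by
  have hmaj : IntegrableOn (fun v => (Iic K₁).indicator (fun _ => K₂) v) (Ioi (0 : ℝ)) := by
    apply IntegrableOn.integrable_indicator _ measurableSet_Iic
    have : volume.restrict (Ioi (0 : ℝ)) (Iic K₁) ≠ ⊤ := by
      rw [Measure.restrict_apply measurableSet_Iic, Set.Iic_inter_Ioi]
      simp [Real.volume_Ioc]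
    exact integrableOn_const this
  have hle : ∫ v in Ioi 0, Φ v ≤ ∫ v in Ioi 0, (Iic K₁).indicator (fun _ => K₂) v :=
    setIntegral_mono_on hΦint hmaj measurableSet_Ioi (fun v hv => hΦ v hv)
  refine hle.trans (le_of_eq ?_)
  rw [setIntegral_indicator measurableSet_Iic, Set.Ioi_inter_Iic, setIntegral_const]
  simp [Measure.real, Real.volume_Ioc, hK₁.le]

/-- **The printed assembly (VI.35)** p.374 [PDF 50] tl.17–27 (image `p50_VI35_s2.png`): «g_k(x) ≤ exp(|Δ|(x⁴[∫_{v<K₁} K₂βv dv − ∫ v dv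
(β²/24)[…](1 + t²)²])) ≤ exp(|Δ|x⁴[K₁K₂ − |log η|]) ≤ 1 (VI.35) if, again, we choose the parameter η in Sect. III sufficiently small
so that |log η| ≥ K₁K₂. This achieves the proof of the lemma.» Kernel-checked on named hypotheses: `hrep` = the representation
(VI.14) in the variables of p.372 (`ln g = |Δ|·x⁴·(∫₀^∞ Φ dv − CT₄)`, `Φ(v) = vF(κ(v)/v, κ(v))` the angle-averaged integrand,
`x⁴CT₄` the third bracket), `h20a`/`h20b` = Lemma VI.2 at the fixed `t, ζ`, `hκ` = «0 ≤ κ ≤ 1», `hCT` = (III.7) as invoked («using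
(III.7)»: `CT₄ ≥ |log η|`), `hη` = «|log η| ≥ K₁K₂». Conclusion `g ≤ 1` = (VI.5) for this cube and background.
[cite: MagnenRivasseauSeneor1993, §VI (VI.35) p.374] -/
theorem dressingFactor_le_one {g vol x η K₁ K₂ CT₄ : ℝ} {F : ℝ → ℝ → ℝ} {κ : ℝ → ℝ}
    (hvol : 0 ≤ vol) (hK₁ : 0 < K₁) (hK₂ : 0 ≤ K₂)
    (hκ : ∀ v, 0 ≤ κ v ∧ κ v ≤ 1)
    (h20a : ∀ β k : ℝ, 0 ≤ k → k ≤ 1 → K₁⁻¹ ≤ β → F β k ≤ K₂ * β)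
    (h20b : ∀ β k : ℝ, 0 ≤ k → k ≤ 1 → 0 ≤ β → β ≤ K₁⁻¹ → F β k ≤ -(β / 8))
    (hint : IntegrableOn (fun v => v * F (κ v / v) (κ v)) (Ioi 0))
    (hrep : Real.log g = vol * x ^ 4 * ((∫ v in Ioi 0, v * F (κ v / v) (κ v)) - CT₄))
    (hg : 0 < g) (hCT : |Real.log η| ≤ CT₄) (hη : K₁ * K₂ ≤ |Real.log η|) :
    g ≤ 1 := by
  have hI : ∫ v in Ioi 0, v * F (κ v / v) (κ v) ≤ K₁ * K₂ :=
    integral_le_K1K2 hK₁ hint (fun v hv => integrand_le_indicator hK₁ hK₂ hκ h20a h20b hv)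
  -- ln g ≤ |Δ| x⁴ (K₁K₂ − |log η|) ≤ 0
  have hbr : (∫ v in Ioi 0, v * F (κ v / v) (κ v)) - CT₄ ≤ K₁ * K₂ - |Real.log η| := by linarith
  have hnonpos : (∫ v in Ioi 0, v * F (κ v / v) (κ v)) - CT₄ ≤ 0 := by linarith
  have hlog : Real.log g ≤ 0 := by
    rw [hrep]
    have hx : 0 ≤ vol * x ^ 4 := by positivity
    exact mul_nonpos_of_nonneg_of_nonpos hx hnonpos
  -- exp is monotone
  have := Real.exp_le_exp.2 hlog
  rwa [Real.exp_log hg, Real.exp_zero] at this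

/-- The middle display of (VI.35) on its own: `|Δ|x⁴[K₁K₂ − |log η|] ≤ 0` once `|log η| ≥ K₁K₂`, hence `exp(…) ≤ 1`.
[cite: MagnenRivasseauSeneor1993, §VI (VI.35) p.374] -/
theorem exp_VI35_le_one {vol x K₁ K₂ η : ℝ} (hvol : 0 ≤ vol) (hη : K₁ * K₂ ≤ |Real.log η|) :
    Real.exp (vol * x ^ 4 * (K₁ * K₂ - |Real.log η|)) ≤ 1 := by
  have h : vol * x ^ 4 * (K₁ * K₂ - |Real.log η|) ≤ 0 :=
    mul_nonpos_of_nonneg_of_nonpos (by positivity) (by linarith)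
  calc Real.exp (vol * x ^ 4 * (K₁ * K₂ - |Real.log η|)) ≤ Real.exp 0 := Real.exp_le_exp.2 h
    _ = 1 := Real.exp_zero

/-- How §5 feeds §1: if for some `η₀ > 0`, every `η ∈ (0, η₀]` and every `(i, α, x, y)` the hypotheses of `dressingFactor_le_one`
are available (the representation (VI.14), Lemma VI.2 at `t = y/x`, (III.7), `|log η| ≥ K₁K₂` — the last being the choice of `η₀`),
then `LemmaVI1Printed` holds: the pointwise bound `g ≤ 1` on `(0, η₀]` IS the predicate.
[cite: MagnenRivasseauSeneor1993, §VI Lemma VI.1 p.369, (VI.35) p.374] -/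
theorem lemmaVI1_of_pointwise (D : DressingFactor) {η₀ : ℝ} (hη₀ : 0 < η₀)
    (h : ∀ η : ℝ, 0 < η → η ≤ η₀ → ∀ (i α : ℕ) (x y : ℝ), D.g η i α x y ≤ 1) : LemmaVI1Printed D :=
  ⟨η₀, hη₀, h⟩

end Stability

end Literature.MathematicalPhysics.QuantumFieldTheory.MagnenRivasseauSeneor1993
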